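import Mathlib.Analysis.Complex.CauchyIntegral
import Mathlib.Analysis.Fourier.AddCircle
import HarnessLib

/-!
# Fourier coefficients of a periodic function analytic and bounded in a strip decay like `e^{-a|j|}`

Topic `Literature/Analysis/Complex` (companion of `PeriodicEntireFourier`, which treats `2πi`-periodic
ENTIRE functions). Everything here is PROVED (no named facts, no definitions).

Let `v : ℂ → ℂ` be `2π`-periodic, holomorphic in the open strip `|Im z| < a` and bounded there by `M`.
Shifting the segment `[0, 2π]` of the coefficient integral `∫₀^{2π} v(x) e^{-ijx} dx` to `[0, 2π] + ib`,
`|b| < a` (Cauchy–Goursat on the rectangle `[0, 2π] × [0, b]`, Mathlib's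
`Complex.integral_boundary_rect_eq_zero_of_differentiableOn`; the vertical sides cancel by periodicity —
`integral_mul_exp_eq_shift_of_periodic_strip`) and choosing `b = ∓a'` according to the sign of `j` gives
`|∫₀^{2π} v(x) e^{-ijx} dx| ≤ 2π M e^{-a'|j|}` for every `a' < a`, hence, letting `a' → a`,

  **`|∫₀^{2π} v(x) e^{-ijx} dx| ≤ 2π M e^{-a|j|}`**, i.e. **`|c_j| ≤ M e^{-a|j|}`** for the Fourier
  coefficients `c_j = (2π)⁻¹ ∫₀^{2π} v e^{-ijx}` (`norm_integral_mul_exp_le_of_periodic_strip`,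
  `norm_fourierCoeff_le_of_periodic_strip`).

This is [cite: TrefethenWeideman2014, §4 eqs. (4.5), (4.11) and the proof of Thm. 4.2 p. 398]
("shift the interval `[0, 2π]` … down a distance `a' < a` into the lower half-plane … the contributions
from the vertical sides vanish by periodicity, and … `|c_j| ≤ M e^{-ja}`"). It is the rigorous content of
the ANALYTICITY-STRIP METHOD of spectral simulations [cite: SulemSulemFrisch1983, §2] — "when the
velocity field is analytic, the energy spectrum `E(k, t)` decays exponentially at large `k` …; the
logarithmic decrement is twice the width `δ(t)` of the analyticity strip of the solution continued to
complex spatial variables" [cite: CichowlasBrachet2005, §3 p. 242] — applied coordinatewise: a field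
analytic and bounded in `|Im x_i| < δ` has Fourier coefficients `O(e^{-δ|k_i|})`, so modal energies are
`O(e^{-2δ|k|_∞})`. (Cell `pub-fluidc`: the typed basis of HOME/STRIP.md's `δ(t)` fits and of the
`δ·k_max` reliability criterion quoted in HOME/LITERATURE.md §C1/§C9; the converse direction and the
algebraic prefactor are not addressed here.)
-/

noncomputable section

open Complex MeasureTheory Set Filter intervalIntegral Real
open scoped Topology

namespace Literature.Analysis.Complex

/-- `e^{-ij(w + 2π)} = e^{-ijw}` for an integer `j` (private helper). [folklore] -/
private theorem exp_neg_I_mul_int_mul_add_two_pi (j : ℤ) (w : ℂ) :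
    Complex.exp (-(I * j * (w + 2 * π))) = Complex.exp (-(I * j * w)) := by
  have h : -(I * j * (w + 2 * π)) = -(I * j * w) + ((-j : ℤ) : ℂ) * (2 * π * I) := by
    push_cast; ring
  rw [h, Complex.exp_add, Complex.exp_int_mul_two_pi_mul_I, mul_one]

/-- **Shifting the coefficient integral inside the strip.** If `v` is holomorphic on the open strip
`|Im z| < a` and `2π`-periodic, then for every integer `j` and every height `b` with `|b| < a`,
`∫₀^{2π} v(x) e^{-ijx} dx = ∫₀^{2π} v(x + ib) e^{-ij(x + ib)} dx` (Cauchy–Goursat on `[0, 2π] × [0, b]`;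
the vertical sides cancel since `w ↦ v(w) e^{-ijw}` is `2π`-periodic).
[cite: TrefethenWeideman2014, §4 (proof of (4.11)), p. 397] -/
theorem integral_mul_exp_eq_shift_of_periodic_strip {v : ℂ → ℂ} {a : ℝ}
    (hd : DifferentiableOn ℂ v {z : ℂ | |z.im| < a}) (hper : ∀ z : ℂ, v (z + 2 * π) = v z)
    (j : ℤ) {b : ℝ} (hb : |b| < a) :
    ∫ x in (0 : ℝ)..2 * π, v x * Complex.exp (-(I * j * x)) =
      ∫ x in (0 : ℝ)..2 * π, v (x + b * I) * Complex.exp (-(I * j * (x + b * I))) := by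
  set g : ℂ → ℂ := fun w ↦ v w * Complex.exp (-(I * j * w)) with hg
  have hgd : DifferentiableOn ℂ g {z : ℂ | |z.im| < a} :=
    hd.mul (by fun_prop : Differentiable ℂ fun w : ℂ ↦ Complex.exp (-(I * j * w))).differentiableOn
  have hgper : ∀ w : ℂ, g (w + 2 * π) = g w := fun w ↦ by
    simp only [hg]
    rw [hper, exp_neg_I_mul_int_mul_add_two_pi]
  -- the closed rectangle `[0, 2π] × [[0, b]]` lies in the open strip
  have hsub : (uIcc (0 : ℂ).re ((2 * π : ℂ) + b * I).re ×ℂ uIcc (0 : ℂ).im ((2 * π : ℂ) + b * I).im) ⊆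
      {z : ℂ | |z.im| < a} := by
    intro z hz
    rw [mem_reProdIm] at hz
    have him : ((2 * π : ℂ) + b * I).im = b := by simp
    rw [Complex.zero_im, him] at hz
    have h2 : |z.im| ≤ |b| := by
      rcases le_total 0 b with h0 | h0
      · rw [uIcc_of_le h0] at hz
        rw [abs_of_nonneg h0, abs_le]
        exact ⟨by linarith [hz.2.1], hz.2.2⟩
      · rw [uIcc_of_ge h0] at hz
        rw [abs_of_nonpos h0, abs_le]
        exact ⟨by linarith [hz.2.1], by linarith [hz.2.2]⟩
    exact lt_of_le_of_lt h2 hb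
  have h := Complex.integral_boundary_rect_eq_zero_of_differentiableOn g 0 ((2 * π : ℂ) + b * I)
    (hgd.mono hsub)
  have hre2 : ((2 * π : ℂ) + b * I).re = 2 * π := by simp
  have him2 : ((2 * π : ℂ) + b * I).im = b := by simp
  rw [Complex.zero_re, Complex.zero_im, hre2, him2] at h
  -- the vertical sides cancel by periodicity
  have hver : (∫ y : ℝ in (0 : ℝ)..b, g (((2 * π : ℝ) : ℂ) + y * I)) = ∫ y : ℝ in (0 : ℝ)..b, g ((0 : ℝ) + y * I) := by
    refine intervalIntegral.integral_congr fun y _ ↦ ?_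
    rw [← hgper ((0 : ℝ) + y * I)]
    congr 1
    push_cast
    ring
  rw [hver, add_sub_assoc, sub_self, add_zero, sub_eq_zero] at h
  have h0 : (∫ x : ℝ in (0 : ℝ)..2 * π, g (x + (0 : ℝ) * I)) = ∫ x : ℝ in (0 : ℝ)..2 * π, g x := by
    refine intervalIntegral.integral_congr fun x _ ↦ ?_
    simp
  rw [h0] at h
  simpa [hg] using h

/-- **`|∫₀^{2π} v e^{-ijx}| ≤ 2π M e^{-a|j|}` for a `2π`-periodic function holomorphic and bounded by `M`
in the open strip `|Im z| < a`** (`a > 0`). [cite: TrefethenWeideman2014, §4 eq. (4.11) and the proof of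
Thm. 4.2, pp. 397–398] -/
theorem norm_integral_mul_exp_le_of_periodic_strip {v : ℂ → ℂ} {a M : ℝ} (ha : 0 < a)
    (hd : DifferentiableOn ℂ v {z : ℂ | |z.im| < a}) (hper : ∀ z : ℂ, v (z + 2 * π) = v z)
    (hM : ∀ z : ℂ, |z.im| < a → ‖v z‖ ≤ M) (j : ℤ) :
    ‖∫ x in (0 : ℝ)..2 * π, v x * Complex.exp (-(I * j * x))‖ ≤ 2 * π * M * Real.exp (-(a * |(j : ℝ)|)) := by
  have h2π : (0 : ℝ) < 2 * π := by positivity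
  -- the bound with any `a' ∈ (0, a)` in place of `a`
  have key : ∀ a' ∈ Ioo 0 a,
      ‖∫ x in (0 : ℝ)..2 * π, v x * Complex.exp (-(I * j * x))‖ ≤ 2 * π * M * Real.exp (-(a' * |(j : ℝ)|)) := by
    intro a' ha'
    -- shift down for `j ≥ 0`, up for `j < 0`
    set b : ℝ := if 0 ≤ j then -a' else a' with hb
    have hba : |b| < a := by
      rw [hb]; split_ifs <;> simp [abs_of_pos ha'.1, ha'.2]
    have hjb : (j : ℝ) * b = -(a' * |(j : ℝ)|) := by
      rw [hb]
      split_ifs with hj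
      · rw [abs_of_nonneg (by exact_mod_cast hj)]; ring
      · rw [abs_of_neg (by exact_mod_cast lt_of_not_ge hj)]; ring
    rw [integral_mul_exp_eq_shift_of_periodic_strip hd hper j hba]
    have hbound : ‖∫ x in (0 : ℝ)..2 * π, v (x + b * I) * Complex.exp (-(I * j * (x + b * I)))‖ ≤
        M * Real.exp (-(a' * |(j : ℝ)|)) * |2 * π - 0| := by
      refine intervalIntegral.norm_integral_le_of_norm_le_const fun x _ ↦ ?_
      rw [norm_mul, Complex.norm_exp]
      have hre : (-(I * (j : ℂ) * ((x : ℂ) + (b : ℂ) * I))).re = (j : ℝ) * b := by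
        simp [Complex.mul_re, Complex.mul_im, Complex.add_re, Complex.add_im]
      rw [hre, hjb]
      have him : ((x : ℂ) + (b : ℂ) * I).im = b := by simp
      exact mul_le_mul_of_nonneg_right (hM _ (by rw [him]; exact hba)) (Real.exp_pos _).le
    rw [sub_zero, abs_of_pos h2π] at hbound
    linarith
  -- let `a' → a⁻`
  have hcont : Tendsto (fun a' : ℝ ↦ 2 * π * M * Real.exp (-(a' * |(j : ℝ)|))) (𝓝[<] a)
      (𝓝 (2 * π * M * Real.exp (-(a * |(j : ℝ)|)))) :=
    ((by fun_prop : Continuous fun a' : ℝ ↦ 2 * π * M * Real.exp (-(a' * |(j : ℝ)|))).tendsto a).mono_left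
      nhdsWithin_le_nhds
  have hev : ∀ᶠ a' in 𝓝[<] a,
      ‖∫ x in (0 : ℝ)..2 * π, v x * Complex.exp (-(I * j * x))‖ ≤ 2 * π * M * Real.exp (-(a' * |(j : ℝ)|)) := by
    filter_upwards [Ioo_mem_nhdsLT ha] with a' ha' using key a' ha'
  exact ge_of_tendsto hcont hev

/-- **The Fourier coefficients `c_j = (2π)⁻¹ ∫₀^{2π} v(x) e^{-ijx} dx` of a `2π`-periodic function
holomorphic and bounded by `M` in the strip `|Im z| < a` satisfy `|c_j| ≤ M e^{-a|j|}`.**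
[cite: TrefethenWeideman2014, §4 eq. (4.11), Thm. 4.2] — the lemma behind the analyticity-strip method
[cite: SulemSulemFrisch1983, §2]: exponential decay of the spectrum with logarithmic decrement (twice, for
energies) the strip width. -/
theorem norm_fourierCoeff_le_of_periodic_strip {v : ℂ → ℂ} {a M : ℝ} (ha : 0 < a)
    (hd : DifferentiableOn ℂ v {z : ℂ | |z.im| < a}) (hper : ∀ z : ℂ, v (z + 2 * π) = v z)
    (hM : ∀ z : ℂ, |z.im| < a → ‖v z‖ ≤ M) (j : ℤ) :
    ‖(1 / (2 * π) : ℂ) * ∫ x in (0 : ℝ)..2 * π, v x * Complex.exp (-(I * j * x))‖ ≤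
      M * Real.exp (-(a * |(j : ℝ)|)) := by
  have h2π : (0 : ℝ) < 2 * π := by positivity
  have h := norm_integral_mul_exp_le_of_periodic_strip ha hd hper hM j
  rw [norm_mul, show (1 / (2 * π) : ℂ) = ((1 / (2 * π) : ℝ) : ℂ) by push_cast; ring, Complex.norm_real,
    Real.norm_of_nonneg (by positivity)]
  rw [div_mul_eq_mul_div, one_mul, div_le_iff₀ h2π]
  linarith

/-- The modal 'energy' form used by the spectra fits: `|c_j|² ≤ M² e^{-2a|j|}` — the logarithmic
decrement of `|c_j|²` is TWICE the strip width. [cite: CichowlasBrachet2005, §3 p. 242] -/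
theorem normSq_fourierCoeff_le_of_periodic_strip {v : ℂ → ℂ} {a M : ℝ} (ha : 0 < a)
    (hd : DifferentiableOn ℂ v {z : ℂ | |z.im| < a}) (hper : ∀ z : ℂ, v (z + 2 * π) = v z)
    (hM : ∀ z : ℂ, |z.im| < a → ‖v z‖ ≤ M) (j : ℤ) :
    ‖(1 / (2 * π) : ℂ) * ∫ x in (0 : ℝ)..2 * π, v x * Complex.exp (-(I * j * x))‖ ^ 2 ≤
      M ^ 2 * Real.exp (-(2 * a * |(j : ℝ)|)) := by
  have h := norm_fourierCoeff_le_of_periodic_strip ha hd hper hM j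
  have hM0 : 0 ≤ M := by
    have := hM 0 (by simpa using ha)
    exact (norm_nonneg _).trans this
  have h2 : M ^ 2 * Real.exp (-(2 * a * |(j : ℝ)|)) = (M * Real.exp (-(a * |(j : ℝ)|))) ^ 2 := by
    rw [mul_pow, ← Real.exp_nat_mul]; ring_nf
  rw [h2]
  exact pow_le_pow_left₀ (norm_nonneg _) h 2

/-! ## The same bound for Mathlib's `fourierCoeff` on `AddCircle (2π)` -/

/-- **Mathlib form.** For any function `F` on `AddCircle (2π)` that agrees with `v` on real points
(e.g. the `Function.Periodic.lift` of `v ∘ (↑)`), the Fourier coefficients `fourierCoeff F j =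
(2π)⁻¹ ∫₀^{2π} e^{-ijx} F(x) dx` satisfy `‖fourierCoeff F j‖ ≤ M e^{-a|j|}`. (The instance
`Fact (0 < 2π)` that `AddCircle (2π)`'s Haar measure needs is taken as an argument, as Mathlib only
provides it locally, e.g. in `Analysis/Polynomial/Fourier`.) [cite: TrefethenWeideman2014, §4 eqs. (4.5), (4.11)] -/
theorem norm_fourierCoeff_addCircle_le_of_periodic_strip [Fact (0 < 2 * π)] {v : ℂ → ℂ} {a M : ℝ} (ha : 0 < a)
    (hd : DifferentiableOn ℂ v {z : ℂ | |z.im| < a}) (hper : ∀ z : ℂ, v (z + 2 * π) = v z)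
    (hM : ∀ z : ℂ, |z.im| < a → ‖v z‖ ≤ M) (F : AddCircle (2 * π) → ℂ)
    (hF : ∀ x : ℝ, F (x : AddCircle (2 * π)) = v x) (j : ℤ) :
    ‖fourierCoeff F j‖ ≤ M * Real.exp (-(a * |(j : ℝ)|)) := by
  have h2π : (0 : ℝ) < 2 * π := Real.two_pi_pos
  rw [fourierCoeff_eq_intervalIntegral F j 0, zero_add]
  have hint : (∫ x in (0 : ℝ)..2 * π, fourier (-j) (x : AddCircle (2 * π)) • F (x : AddCircle (2 * π))) =
      ∫ x in (0 : ℝ)..2 * π, v x * Complex.exp (-(I * j * x)) := by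
    refine intervalIntegral.integral_congr fun x _ ↦ ?_
    simp only [fourier_coe_apply, hF, smul_eq_mul]
    rw [mul_comm]
    congr 2
    have hπ : (π : ℂ) ≠ 0 := by exact_mod_cast Real.pi_pos.ne'
    push_cast
    field_simp
  rw [hint, norm_smul, Real.norm_of_nonneg (by positivity)]
  have h := norm_integral_mul_exp_le_of_periodic_strip ha hd hper hM j
  rw [div_mul_eq_mul_div, one_mul, div_le_iff₀ h2π]
  linarith

end Literature.Analysis.Complex

end
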